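import Literature.MathematicalPhysics.QuantumLattice.XYHelicalTwist
import Literature.MathematicalPhysics.QuantumLattice.LatticeToriProofs
import HarnessLib

/-!
# Gauge twists of the ferromagnetic quantum XY model at general spin: twisted bonds and the star rule

Trunk T-QLATTICE (Literature/MathematicalPhysics/QuantumLattice); companion to `XYHelicalTwist.lean`
(the spin-`1/2` commensurate helix), generalising its perturbation algebra to EVERY spin `n/2` and
EVERY gauge function `ψ`. Filed by the standing disprover of the crux `XYOrderOpennessLargeSpin`
(route `HubbardSuperconductivity/AposterioriCapRg`, stmt-HubbardSuperconductivity-13895); siblings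
`XYTwistedOrderEngine.lean` (the order-parameter engine) and `XYGaugeTwistWitnesses.lean` (two
admissible gauges). Everything here is finite-dimensional matrix algebra and is tagged folklore.

## Contents (namespace `XYGaugeTwist`)

* `bondCoef δ = (1 - e^{iδ})/2`; `twistBond n δ a b = c(δ) S⁺_aS⁻_b + conj c(δ) S⁻_aS⁺_b =
  (1 - cos δ) X_{ab} - sin δ · Y_{ab}` (`twistBond_eq_real`); reversal `T(δ)_{ba} = T(-δ)_{ab}`,
  Hermiticity, support, covariance under relabelling, `U(1)` invariance, and dependence on `δ` only
  through `e^{iδ}` (`twistBond_congr`); the conjugation identity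
  `X_{ab} - R_ψ X_{ab} R_ψᴴ = T(ψ_b - ψ_a)_{ab}` (`xyPair_sub_helixTwist_conj`, `R_ψ = helixTwist n ψ`).
* On the torus (`L ≥ 3`, every spin): `H = -Σ_x Σᵢ X_{x,x+eᵢ}` and
  `R_ψ H R_ψᴴ = H + Σ_x Σᵢ T(ψ_{x+eᵢ} - ψ_x)_{x,x+eᵢ}` (`helixTwist_conj_xyTorus`).
* The STAR-attributed local rule `wStar L n ψ ε x = (2ε)⁻¹ Σ_{b ∼ x} T(ψ_b - ψ_x)_{x,b}` (four
  neighbours): `H + ε Σ_x w⋆_x = R_ψ H R_ψᴴ` (`xyTorus_add_smul_sum_wStar`), range `1`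
  (`isSupportedOn_wStar`), `U(1)` (`commute_wStar_totalSpin`), Hermitian, translation covariant when
  the increments of `ψ` are translation invariant modulo `2π` (`reindexOp_addRight_wStar`),
  site-inversion covariant when `ψ` is EVEN (`reindexOp_neg_wStar`; modulo `2π`: `reindexOp_neg_wStar'`).
* Loewner sandwich at general spin: `(|c|S²)·1 - c Sᵅ_aSᵝ_b ≥ 0`, the bond sandwich
  `2(|u|+|v|)S²·1 ∓ (uX + vY) ≥ 0`, and the spectrum of `w⋆_x` in `[-1, 1]` when the four increments
  satisfy `|1 - cos δ| ≤ η`, `|sin δ| ≤ η` with `8ηS² ≤ |ε|` (`wStar_eigenvalues`).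

## Sources

* T. Kennedy, E. H. Lieb, B. S. Shastry, PRL 61 (1988) 2582 (`KLS1988PRL`): the model.
* H. Tasaki, *Physics and Mathematics of Quantum Many-Body Systems* (2020), §2.1–2.2: rotations
  about the `3`-axis `e^{-iθSᶻ} S^± e^{iθSᶻ} = e^{∓iθ} S^±`, `U(1)` symmetry.
* I. Dzyaloshinsky, J. Phys. Chem. Solids 4 (1958) 241; T. Moriya, Phys. Rev. 120 (1960) 91: the
  gauge (spiral) transformation of a planar magnet with a phase twist.

## Design

Concrete matrices throughout (`Op`, `onSite`, `siteRaise`, `helixTwist`), as in `XYHelicalTwist.lean`;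
the spin `n` is explicit; increments enter only through `e^{iδ}` so that gauges built from
`torusPhase` (wrapping representatives) are handled by their character values; the star
attribution (each site carries half of each of its four bonds) is what makes inversion covariance
termwise for even gauges.
-/

noncomputable section

open Matrix Complex Finset
open scoped ComplexOrder
open Literature.MathematicalPhysics.QuantumLattice Literature.Probability.LatticeModels

namespace Literature.MathematicalPhysics.QuantumLattice

namespace XYGaugeTwist

/-! ### The twisted bond term at general spin `n/2` -/

section TwistBond

variable {Λ : Type*} [Fintype Λ] [DecidableEq Λ]

/-- The bond coefficient `c(δ) = (1 - e^{iδ})/2`. [folklore] -/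
def bondCoef (δ : ℝ) : ℂ := (1 - Complex.exp ((δ : ℂ) * I)) / 2

/-- `c(δ) = (1 - cos δ)/2 - i sin δ / 2`. [folklore] -/
theorem bondCoef_eq (δ : ℝ) :
    bondCoef δ = (((1 - Real.cos δ) / 2 : ℝ) : ℂ) + (((-Real.sin δ) / 2 : ℝ) : ℂ) * I := by
  rw [bondCoef, Complex.exp_mul_I, ← Complex.ofReal_cos, ← Complex.ofReal_sin]
  push_cast
  ring

/-- `2 Re c(δ) = 1 - cos δ`. [folklore] -/
theorem two_mul_bondCoef_re (δ : ℝ) : 2 * (bondCoef δ).re = 1 - Real.cos δ := by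
  rw [bondCoef_eq]
  simp only [Complex.add_re, Complex.ofReal_re, Complex.mul_re, Complex.I_re, Complex.ofReal_im,
    Complex.I_im, mul_zero, mul_one, sub_zero, add_zero]
  ring

/-- `2 Im c(δ) = -sin δ`. [folklore] -/
theorem two_mul_bondCoef_im (δ : ℝ) : 2 * (bondCoef δ).im = -Real.sin δ := by
  rw [bondCoef_eq]
  simp only [Complex.add_im, Complex.ofReal_im, Complex.mul_im, Complex.I_re, Complex.ofReal_re,
    Complex.I_im, mul_zero, mul_one, zero_add, add_zero]
  ring

/-- `conj c(δ) = c(-δ)`. [folklore] -/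
theorem star_bondCoef (δ : ℝ) : star (bondCoef δ) = bondCoef (-δ) := by
  rw [bondCoef, bondCoef, star_div₀, star_sub, star_one, star_cexp_mul_I]
  simp only [star_ofNat]

/-- `c(0) = 0`. [folklore] -/
@[simp] theorem bondCoef_zero : bondCoef 0 = 0 := by
  simp [bondCoef]

/-- `c` depends on `δ` only through `e^{iδ}`. [folklore] -/
theorem bondCoef_congr {δ δ' : ℝ} (h : Complex.exp ((δ : ℂ) * I) = Complex.exp ((δ' : ℂ) * I)) :
    bondCoef δ = bondCoef δ' := by
  rw [bondCoef, bondCoef, h]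

/-- The twisted bond term `T(δ)_{ab} = c(δ) S⁺_aS⁻_b + conj c(δ) S⁻_aS⁺_b`. [folklore] -/
def twistBond (n : ℕ) (δ : ℝ) (a b : Λ) : Op Λ (n + 1) :=
  bondCoef δ • raiseLowerPair n a b + star (bondCoef δ) • lowerRaisePair n a b

/-- Real form `T(δ)_{ab} = (1 - cos δ) X_{ab} - sin δ · Y_{ab}`. [folklore] -/
theorem twistBond_eq_real (n : ℕ) (δ : ℝ) (a b : Λ) :
    twistBond n δ a b =
      ((1 - Real.cos δ : ℝ) : ℂ) • xyPair n a b + ((-Real.sin δ : ℝ) : ℂ) • dmPair n a b := by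
  rw [twistBond, smul_raiseLowerPair_add_smul_lowerRaisePair, two_mul_bondCoef_re,
    two_mul_bondCoef_im]

/-- `T(0) = 0`. [folklore] -/
@[simp] theorem twistBond_zero (n : ℕ) (a b : Λ) : twistBond n 0 a b = 0 := by
  simp [twistBond]

/-- `T(δ)` depends on `δ` only through `e^{iδ}`. [folklore] -/
theorem twistBond_congr (n : ℕ) {δ δ' : ℝ}
    (h : Complex.exp ((δ : ℂ) * I) = Complex.exp ((δ' : ℂ) * I)) (a b : Λ) :
    twistBond n δ a b = twistBond n δ' a b := by
  rw [twistBond, twistBond, bondCoef_congr h]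

/-- `S⁺_bS⁻_a = S⁻_aS⁺_b` for `a ≠ b`. [folklore] -/
theorem raiseLowerPair_swap (n : ℕ) {a b : Λ} (hab : a ≠ b) :
    raiseLowerPair n b a = lowerRaisePair n a b := by
  rw [raiseLowerPair, lowerRaisePair, siteRaise, siteLower, onSite_mul_onSite_comm (Ne.symm hab)]

/-- `S⁻_bS⁺_a = S⁺_aS⁻_b` for `a ≠ b`. [folklore] -/
theorem lowerRaisePair_swap (n : ℕ) {a b : Λ} (hab : a ≠ b) :
    lowerRaisePair n b a = raiseLowerPair n a b := by
  rw [raiseLowerPair, lowerRaisePair, siteRaise, siteLower, onSite_mul_onSite_comm (Ne.symm hab)]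

/-- Reversing the bond reverses the twist: `T(δ)_{ba} = T(-δ)_{ab}` (`a ≠ b`). [folklore] -/
theorem twistBond_swap (n : ℕ) (δ : ℝ) {a b : Λ} (hab : a ≠ b) :
    twistBond n δ b a = twistBond n (-δ) a b := by
  rw [twistBond, twistBond, raiseLowerPair_swap n hab, lowerRaisePair_swap n hab,
    star_bondCoef (-δ), neg_neg, ← star_bondCoef δ]
  exact add_comm _ _

/-- `T(δ)_{ab}` is Hermitian (`a ≠ b`). [folklore] -/
theorem twistBond_isHermitian (n : ℕ) (δ : ℝ) {a b : Λ} (hab : a ≠ b) :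
    (twistBond n δ a b).IsHermitian := by
  rw [IsHermitian, twistBond, conjTranspose_add, conjTranspose_smul, conjTranspose_smul,
    raiseLowerPair_conjTranspose hab, lowerRaisePair_conjTranspose hab, star_star]
  exact add_comm _ _

/-- `T(δ)_{ab}` is supported on any region containing `a`, `b`. [folklore] -/
theorem isSupportedOn_twistBond (n : ℕ) (δ : ℝ) {a b : Λ} {X : Finset Λ} (ha : a ∈ X)
    (hb : b ∈ X) : IsSupportedOn (twistBond n δ a b) X :=
  IsSupportedOn.add (IsSupportedOn.smul (isSupportedOn_raiseLowerPair n ha hb) _)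
    (IsSupportedOn.smul (isSupportedOn_lowerRaisePair n ha hb) _)

/-- Covariance of `T(δ)_{ab}` under relabelling of the sites. [folklore] -/
theorem reindexOp_twistBond {Λ' : Type*} [Fintype Λ'] [DecidableEq Λ'] (e : Λ ≃ Λ') (n : ℕ)
    (δ : ℝ) (a b : Λ) : reindexOp e (twistBond n δ a b) = twistBond n δ (e a) (e b) := by
  rw [twistBond, twistBond, map_add, map_smul, map_smul, reindexOp_raiseLowerPair,
    reindexOp_lowerRaisePair]

/-- `U(1)` invariance: `[T(δ)_{ab}, Sᶻ_tot] = 0`. [folklore] -/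
theorem commute_twistBond_totalSpin (n : ℕ) (δ : ℝ) (a b : Λ) :
    Commute (twistBond n δ a b) (totalSpin n 2) :=
  Commute.add_left ((commute_raiseLowerPair_totalSpin n a b).smul_left _)
    ((commute_lowerRaisePair_totalSpin n a b).smul_left _)

/-- **The conjugation identity**: `X_{ab} - R_ψ X_{ab} R_ψᴴ = T(ψ_b - ψ_a)_{ab}`. [folklore] -/
theorem xyPair_sub_helixTwist_conj (n : ℕ) (ψ : Λ → ℝ) (a b : Λ) :
    xyPair n a b - helixTwist n ψ * xyPair n a b * (helixTwist n ψ)ᴴ =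
      twistBond n (ψ b - ψ a) a b := by
  rw [xyPair_eq, mul_smul_comm, smul_mul_assoc, mul_add, add_mul, helixTwist_conj_raiseLowerPair,
    helixTwist_conj_lowerRaisePair, twistBond, star_bondCoef, bondCoef, bondCoef]
  have e : (((-(ψ b - ψ a) : ℝ)) : ℂ) = ((ψ a - ψ b : ℝ) : ℂ) := by push_cast; ring
  rw [e]
  simp only [smul_add, smul_smul]
  module

end TwistBond

/-! ### The gauge identity on the torus at general spin -/

section Torus

variable (L : ℕ) [NeZero L] (n : ℕ)

/-- `H = -Σ_x Σᵢ X_{x,x+eᵢ}` for every spin (`L ≥ 3`). [folklore] -/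
theorem xyTorus_eq_neg_sum_xyPair (hL : 3 ≤ L) :
    xyTorus 2 L n = -∑ x : TorusSite 2 L, ∑ i : Fin 2, xyPair n x (x + Pi.single i 1) := by
  rw [xyTorus_eq_bondSum, ← sum_pairs_eq_sum_edgeFinset' L hL, ← Finset.sum_neg_distrib]
  refine Finset.sum_congr rfl fun x _ => ?_
  rw [← Finset.sum_neg_distrib]
  refine Finset.sum_congr rfl fun i _ => ?_
  rw [Sym2.lift_mk]
  change ((-1 : ℝ) : ℂ) • spinBond n 0 x (x + Pi.single i 1) +
      ((-1 : ℝ) : ℂ) • spinBond n 1 x (x + Pi.single i 1) +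
      ((0 : ℝ) : ℂ) • spinBond n 2 x (x + Pi.single i 1) = -xyPair n x (x + Pi.single i 1)
  rw [← spinBond_zero_add_one (XYHelix.add_single_ne L (by omega) x i)]
  push_cast
  module

/-- **The twisted torus Hamiltonian**: `R_ψ H R_ψᴴ = H + Σ_x Σᵢ T(ψ_{x+eᵢ} - ψ_x)_{x,x+eᵢ}`
(`L ≥ 3`, every spin, every gauge function `ψ`). [folklore] -/
theorem helixTwist_conj_xyTorus (hL : 3 ≤ L) (ψ : TorusSite 2 L → ℝ) :
    helixTwist n ψ * xyTorus 2 L n * (helixTwist n ψ)ᴴ =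
      xyTorus 2 L n + ∑ x : TorusSite 2 L, ∑ i : Fin 2,
        twistBond n (ψ (x + Pi.single i 1) - ψ x) x (x + Pi.single i 1) := by
  have key : ∀ (x : TorusSite 2 L) (i : Fin 2),
      helixTwist n ψ * xyPair n x (x + Pi.single i 1) * (helixTwist n ψ)ᴴ =
        xyPair n x (x + Pi.single i 1) -
          twistBond n (ψ (x + Pi.single i 1) - ψ x) x (x + Pi.single i 1) := fun x i => by
    rw [← xyPair_sub_helixTwist_conj, sub_sub_cancel]
  rw [xyTorus_eq_neg_sum_xyPair L n hL, mul_neg, neg_mul, Finset.mul_sum, Finset.sum_mul]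
  simp_rw [Finset.mul_sum, Finset.sum_mul, key, Finset.sum_sub_distrib]
  abel

/-! ### The star-attributed local rule -/

/-- The local rule `w⋆_x = (2ε)⁻¹ Σ_{b ∼ x} T(ψ_b - ψ_x)_{x,b}` (sum over the four neighbours). [folklore] -/
def wStar (ψ : TorusSite 2 L → ℝ) (ε : ℝ) (x : TorusSite 2 L) : Op (TorusSite 2 L) (n + 1) :=
  (((2 * ε)⁻¹ : ℝ) : ℂ) • ∑ i : Fin 2,
    (twistBond n (ψ (x + Pi.single i 1) - ψ x) x (x + Pi.single i 1) +
      twistBond n (ψ (x - Pi.single i 1) - ψ x) x (x - Pi.single i 1))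

omit [NeZero L] in
/-- `x - eᵢ ≠ x` on a torus of side `≥ 2`. [folklore] -/
theorem sub_single_ne (hL : 2 ≤ L) (x : TorusSite 2 L) (i : Fin 2) : x ≠ x - Pi.single i 1 := by
  intro h
  have h' := XYHelix.add_single_ne L hL (x - Pi.single i 1) i
  rw [sub_add_cancel] at h'
  exact h' h.symm

/-- The backward bonds re-attributed: `Σ_x T(ψ_{x-eᵢ} - ψ_x)_{x,x-eᵢ} = Σ_x T(ψ_{x+eᵢ} - ψ_x)_{x,x+eᵢ}`. [folklore] -/
theorem sum_twistBond_backward (hL : 2 ≤ L) (ψ : TorusSite 2 L → ℝ) (i : Fin 2) :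
    ∑ x : TorusSite 2 L, twistBond n (ψ (x - Pi.single i 1) - ψ x) x (x - Pi.single i 1) =
      ∑ x : TorusSite 2 L, twistBond n (ψ (x + Pi.single i 1) - ψ x) x (x + Pi.single i 1) := by
  rw [← Equiv.sum_comp (Equiv.addRight (Pi.single i (1 : ZMod L)))]
  refine Finset.sum_congr rfl fun x _ => ?_
  simp only [Equiv.coe_addRight, add_sub_cancel_right]
  rw [twistBond_swap n _ (XYHelix.add_single_ne L hL x i), neg_sub]

/-- `ε Σ_x w⋆_x = Σ_x Σᵢ T(ψ_{x+eᵢ} - ψ_x)_{x,x+eᵢ}`. [folklore] -/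
theorem smul_sum_wStar (hL : 2 ≤ L) (ψ : TorusSite 2 L → ℝ) {ε : ℝ} (hε : ε ≠ 0) :
    (ε : ℂ) • ∑ x, wStar L n ψ ε x =
      ∑ x : TorusSite 2 L, ∑ i : Fin 2,
        twistBond n (ψ (x + Pi.single i 1) - ψ x) x (x + Pi.single i 1) := by
  have hb : ∀ i : Fin 2, ∑ x : TorusSite 2 L,
      twistBond n (ψ (x - Pi.single i 1) - ψ x) x (x - Pi.single i 1) =
      ∑ x : TorusSite 2 L, twistBond n (ψ (x + Pi.single i 1) - ψ x) x (x + Pi.single i 1) :=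
    fun i => sum_twistBond_backward L n hL ψ i
  simp only [wStar]
  rw [← Finset.smul_sum, smul_smul, Finset.sum_comm]
  simp_rw [Finset.sum_add_distrib, hb]
  rw [← two_smul ℂ, smul_smul, Finset.sum_comm]
  have hε' : (ε : ℂ) ≠ 0 := Complex.ofReal_ne_zero.2 hε
  have hc : (ε : ℂ) * (((2 * ε)⁻¹ : ℝ) : ℂ) * 2 = 1 := by
    push_cast
    field_simp
  rw [hc, one_smul]

/-- **The gauge identity for the star rule**: `H + ε Σ_x w⋆_x = R_ψ H R_ψᴴ` (`L ≥ 3`). [folklore] -/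
theorem xyTorus_add_smul_sum_wStar (hL : 3 ≤ L) (ψ : TorusSite 2 L → ℝ) {ε : ℝ} (hε : ε ≠ 0) :
    xyTorus 2 L n + (ε : ℂ) • ∑ x, wStar L n ψ ε x =
      helixTwist n ψ * xyTorus 2 L n * (helixTwist n ψ)ᴴ := by
  rw [smul_sum_wStar L n (by omega) ψ hε, helixTwist_conj_xyTorus L n hL]

/-- `U(1)` invariance of the star rule. [folklore] -/
theorem commute_wStar_totalSpin (ψ : TorusSite 2 L → ℝ) (ε : ℝ) (x : TorusSite 2 L) :
    Commute (wStar L n ψ ε x) (totalSpin n 2) := by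
  rw [wStar]
  refine Commute.smul_left (Commute.sum_left _ _ _ fun i _ => Commute.add_left ?_ ?_) _
  · exact commute_twistBond_totalSpin n _ _ _
  · exact commute_twistBond_totalSpin n _ _ _

/-- `dist(x, x - eᵢ) ≤ 1`. [folklore] -/
theorem torusDist_sub_single_le (x : TorusSite 2 L) (i : Fin 2) :
    torusDist x (x - Pi.single i 1) ≤ 1 := by
  rw [torusDist_comm_holds]
  have h := XYHelix.torusDist_add_single_le L (x - Pi.single i 1) i
  rwa [sub_add_cancel] at h

/-- The star rule has range `1`. [folklore] -/
theorem isSupportedOn_wStar (ψ : TorusSite 2 L → ℝ) (ε : ℝ) (x : TorusSite 2 L) :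
    IsSupportedOn (wStar L n ψ ε x) (torusBall x 1) := by
  rw [wStar]
  refine IsSupportedOn.smul (IsSupportedOn.sum _ fun i _ => IsSupportedOn.add ?_ ?_) _
  · exact isSupportedOn_twistBond n _ (mem_torusBall_self x 1)
      (mem_torusBall_iff.2 (XYHelix.torusDist_add_single_le L x i))
  · exact isSupportedOn_twistBond n _ (mem_torusBall_self x 1)
      (mem_torusBall_iff.2 (torusDist_sub_single_le L x i))

/-- The star rule is Hermitian (`L ≥ 2`). [folklore] -/
theorem wStar_isHermitian (hL : 2 ≤ L) (ψ : TorusSite 2 L → ℝ) (ε : ℝ) (x : TorusSite 2 L) :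
    (wStar L n ψ ε x).IsHermitian := by
  have hs : (∑ i : Fin 2, (twistBond n (ψ (x + Pi.single i 1) - ψ x) x (x + Pi.single i 1) +
      twistBond n (ψ (x - Pi.single i 1) - ψ x) x (x - Pi.single i 1))).IsHermitian := by
    rw [IsHermitian, conjTranspose_sum]
    refine Finset.sum_congr rfl fun i _ => ?_
    rw [conjTranspose_add, (twistBond_isHermitian n _ (XYHelix.add_single_ne L hL x i)).eq,
      (twistBond_isHermitian n _ (sub_single_ne L hL x i)).eq]
  rw [wStar]
  refine IsHermitian.smul hs ?_
  rw [isSelfAdjoint_iff, Complex.star_def, Complex.conj_ofReal]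

/-- Translation covariance of the star rule, for gauges with translation-invariant increments
(mod `2π`). [folklore] -/
theorem reindexOp_addRight_wStar (ψ : TorusSite 2 L → ℝ)
    (hψ : ∀ x y v : TorusSite 2 L,
      Complex.exp (((ψ (x + v) - ψ (y + v) : ℝ) : ℂ) * I) =
        Complex.exp (((ψ x - ψ y : ℝ) : ℂ) * I))
    (ε : ℝ) (x v : TorusSite 2 L) :
    reindexOp (Equiv.addRight v) (wStar L n ψ ε x) = wStar L n ψ ε (x + v) := by
  rw [wStar, wStar, map_smul, map_sum]
  congr 1
  refine Finset.sum_congr rfl fun i _ => ?_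
  rw [map_add, reindexOp_twistBond, reindexOp_twistBond]
  simp only [Equiv.coe_addRight]
  rw [twistBond_congr n (hψ (x + Pi.single i 1) x v).symm,
    twistBond_congr n (hψ (x - Pi.single i 1) x v).symm]
  simp only [add_right_comm x (Pi.single i 1) v, sub_add_eq_add_sub x (Pi.single i 1) v]

/-- Site-inversion covariance of the star rule, for gauges that are even modulo `2π`
(`e^{i(ψ_{-a} - ψ_{-b})} = e^{i(ψ_a - ψ_b)}`). [folklore] -/
theorem reindexOp_neg_wStar' (ψ : TorusSite 2 L → ℝ)
    (hψ : ∀ a b : TorusSite 2 L,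
      Complex.exp (((ψ (-a) - ψ (-b) : ℝ) : ℂ) * I) = Complex.exp (((ψ a - ψ b : ℝ) : ℂ) * I))
    (ε : ℝ) (x : TorusSite 2 L) :
    reindexOp (Equiv.neg (TorusSite 2 L)) (wStar L n ψ ε x) = wStar L n ψ ε (-x) := by
  rw [wStar, wStar, map_smul, map_sum]
  congr 1
  refine Finset.sum_congr rfl fun i _ => ?_
  rw [map_add, reindexOp_twistBond, reindexOp_twistBond]
  simp only [Equiv.neg_apply]
  rw [twistBond_congr n (hψ (x + Pi.single i 1) x).symm,
    twistBond_congr n (hψ (x - Pi.single i 1) x).symm]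
  have e1 : -(x + Pi.single i 1) = -x - Pi.single i 1 := neg_add' x _
  have e2 : -(x - Pi.single i 1) = -x + Pi.single i 1 := by abel
  simp only [e1, e2]
  exact add_comm _ _

/-- Site-inversion covariance of the star rule, for EVEN gauges. [folklore] -/
theorem reindexOp_neg_wStar (ψ : TorusSite 2 L → ℝ) (hψ : ∀ x, ψ (-x) = ψ x) (ε : ℝ)
    (x : TorusSite 2 L) :
    reindexOp (Equiv.neg (TorusSite 2 L)) (wStar L n ψ ε x) = wStar L n ψ ε (-x) :=
  reindexOp_neg_wStar' L n ψ (fun a b => by rw [hψ, hψ]) ε x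

end Torus


/-! ### Loewner sandwich and the spectrum of the star rule -/

section Loewner

variable {Λ : Type*} [Fintype Λ] [DecidableEq Λ]

open scoped MatrixOrder

/-- Signed Loewner bound at general spin: `(|c| S²)·1 - c·Sᵅ_a Sᵝ_b ≥ 0` (`a ≠ b`, `S = n/2`). [folklore] -/
theorem posSemidef_abs_smul_one_sub_smul_mul_gen (n : ℕ) {a b : Λ} (hab : a ≠ b) (α β : Fin 3)
    (c : ℝ) :
    Matrix.PosSemidef ((((|c| * ((n : ℝ) / 2) ^ 2 : ℝ)) : ℂ) • (1 : Op Λ (n + 1)) -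
      (c : ℂ) • (siteSpin n a α * siteSpin n b β)) := by
  rcases le_or_gt 0 c with hc | hc
  · have e : (((|c| * ((n : ℝ) / 2) ^ 2 : ℝ)) : ℂ) • (1 : Op Λ (n + 1)) -
        (c : ℂ) • (siteSpin n a α * siteSpin n b β) =
        (c : ℂ) • ((((n : ℂ)) / 2) ^ 2 • (1 : Op Λ (n + 1)) - siteSpin n a α * siteSpin n b β) := by
      rw [abs_of_nonneg hc, smul_sub, smul_smul]
      push_cast
      rfl
    rw [e]
    exact (posSemidef_sq_smul_one_sub_mul n hab α β).smul (Complex.zero_le_real.2 hc)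
  · have e : (((|c| * ((n : ℝ) / 2) ^ 2 : ℝ)) : ℂ) • (1 : Op Λ (n + 1)) -
        (c : ℂ) • (siteSpin n a α * siteSpin n b β) =
        ((-c : ℝ) : ℂ) • ((((n : ℂ)) / 2) ^ 2 • (1 : Op Λ (n + 1)) +
          siteSpin n a α * siteSpin n b β) := by
      rw [abs_of_neg hc, smul_add, smul_smul]
      push_cast
      module
    rw [e]
    exact (posSemidef_sq_smul_one_add_mul n hab α β).smul (Complex.zero_le_real.2 (by linarith))

/-- The bond sandwich: `2(|u|+|v|)S²·1 ∓ (u X_{ab} + v Y_{ab}) ≥ 0` (`a ≠ b`). [folklore] -/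
theorem posSemidef_sandwich_xy_dm (n : ℕ) {a b : Λ} (hab : a ≠ b) (u v : ℝ) :
    Matrix.PosSemidef ((((2 * (|u| + |v|) * ((n : ℝ) / 2) ^ 2 : ℝ)) : ℂ) • (1 : Op Λ (n + 1)) -
        ((u : ℂ) • xyPair n a b + (v : ℂ) • dmPair n a b)) ∧
      Matrix.PosSemidef ((((2 * (|u| + |v|) * ((n : ℝ) / 2) ^ 2 : ℝ)) : ℂ) • (1 : Op Λ (n + 1)) +
        ((u : ℂ) • xyPair n a b + (v : ℂ) • dmPair n a b)) := by
  set K : ℝ := ((n : ℝ) / 2) ^ 2 with hK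
  have hsplit : (((2 * (|u| + |v|) * K : ℝ)) : ℂ) = (((|u| * K : ℝ)) : ℂ) + (((|u| * K : ℝ)) : ℂ) +
      (((|v| * K : ℝ)) : ℂ) + (((|-v| * K : ℝ)) : ℂ) := by
    rw [abs_neg]; push_cast; ring
  constructor
  · have e : (((2 * (|u| + |v|) * K : ℝ)) : ℂ) • (1 : Op Λ (n + 1)) -
        ((u : ℂ) • xyPair n a b + (v : ℂ) • dmPair n a b) =
        ((((|u| * K : ℝ)) : ℂ) • 1 - (u : ℂ) • (siteSpin n a 0 * siteSpin n b 0)) +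
        ((((|u| * K : ℝ)) : ℂ) • 1 - (u : ℂ) • (siteSpin n a 1 * siteSpin n b 1)) +
        ((((|v| * K : ℝ)) : ℂ) • 1 - (v : ℂ) • (siteSpin n a 0 * siteSpin n b 1)) +
        ((((|-v| * K : ℝ)) : ℂ) • 1 - ((-v : ℝ) : ℂ) • (siteSpin n a 1 * siteSpin n b 0)) := by
      rw [hsplit, xyPair, dmPair]
      push_cast
      module
    rw [e]
    exact (((posSemidef_abs_smul_one_sub_smul_mul_gen n hab 0 0 u).add
      (posSemidef_abs_smul_one_sub_smul_mul_gen n hab 1 1 u)).add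
      (posSemidef_abs_smul_one_sub_smul_mul_gen n hab 0 1 v)).add
      (posSemidef_abs_smul_one_sub_smul_mul_gen n hab 1 0 (-v))
  · have e : (((2 * (|u| + |v|) * K : ℝ)) : ℂ) • (1 : Op Λ (n + 1)) +
        ((u : ℂ) • xyPair n a b + (v : ℂ) • dmPair n a b) =
        ((((|-u| * K : ℝ)) : ℂ) • 1 - ((-u : ℝ) : ℂ) • (siteSpin n a 0 * siteSpin n b 0)) +
        ((((|-u| * K : ℝ)) : ℂ) • 1 - ((-u : ℝ) : ℂ) • (siteSpin n a 1 * siteSpin n b 1)) +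
        ((((|-v| * K : ℝ)) : ℂ) • 1 - ((-v : ℝ) : ℂ) • (siteSpin n a 0 * siteSpin n b 1)) +
        ((((|v| * K : ℝ)) : ℂ) • 1 - (v : ℂ) • (siteSpin n a 1 * siteSpin n b 0)) := by
      rw [hsplit, xyPair, dmPair, abs_neg, abs_neg]
      push_cast
      module
    rw [e]
    exact (((posSemidef_abs_smul_one_sub_smul_mul_gen n hab 0 0 (-u)).add
      (posSemidef_abs_smul_one_sub_smul_mul_gen n hab 1 1 (-u))).add
      (posSemidef_abs_smul_one_sub_smul_mul_gen n hab 0 1 (-v))).add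
      (posSemidef_abs_smul_one_sub_smul_mul_gen n hab 1 0 v)

/-- Scaled bond sandwich in twist form: if `|1 - cos δ| ≤ η`, `|sin δ| ≤ η` then
`4|κ|η S²·1 ∓ κ T(δ)_{ab} ≥ 0`. [folklore] -/
theorem posSemidef_sandwich_twistBond (n : ℕ) {a b : Λ} (hab : a ≠ b) {δ η : ℝ} (κ : ℝ)
    (h1 : |1 - Real.cos δ| ≤ η) (h2 : |Real.sin δ| ≤ η) :
    Matrix.PosSemidef ((((4 * |κ| * η * ((n : ℝ) / 2) ^ 2 : ℝ)) : ℂ) • (1 : Op Λ (n + 1)) -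
        (κ : ℂ) • twistBond n δ a b) ∧
      Matrix.PosSemidef ((((4 * |κ| * η * ((n : ℝ) / 2) ^ 2 : ℝ)) : ℂ) • (1 : Op Λ (n + 1)) +
        (κ : ℂ) • twistBond n δ a b) := by
  set K : ℝ := ((n : ℝ) / 2) ^ 2 with hK
  have hK0 : 0 ≤ K := by positivity
  set u : ℝ := κ * (1 - Real.cos δ) with hu
  set v : ℝ := κ * (-Real.sin δ) with hv
  have hT : (κ : ℂ) • twistBond n δ a b = (u : ℂ) • xyPair n a b + (v : ℂ) • dmPair n a b := by
    rw [twistBond_eq_real, smul_add, smul_smul, smul_smul, hu, hv]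
    push_cast
    rfl
  have huv : 2 * (|u| + |v|) * K ≤ 4 * |κ| * η * K := by
    have hu' : |u| ≤ |κ| * η := by
      rw [hu, abs_mul]; exact mul_le_mul_of_nonneg_left h1 (abs_nonneg κ)
    have hv' : |v| ≤ |κ| * η := by
      rw [hv, abs_mul, abs_neg]; exact mul_le_mul_of_nonneg_left h2 (abs_nonneg κ)
    nlinarith
  obtain ⟨hm, hp⟩ := posSemidef_sandwich_xy_dm n hab u v
  have hgap : Matrix.PosSemidef ((((4 * |κ| * η * K - 2 * (|u| + |v|) * K : ℝ)) : ℂ) •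
      (1 : Op Λ (n + 1))) :=
    PosSemidef.one.smul (Complex.zero_le_real.2 (by linarith))
  constructor
  · have e : (((4 * |κ| * η * K : ℝ)) : ℂ) • (1 : Op Λ (n + 1)) - (κ : ℂ) • twistBond n δ a b =
        (((4 * |κ| * η * K - 2 * (|u| + |v|) * K : ℝ)) : ℂ) • (1 : Op Λ (n + 1)) +
        ((((2 * (|u| + |v|) * K : ℝ)) : ℂ) • (1 : Op Λ (n + 1)) -
          ((u : ℂ) • xyPair n a b + (v : ℂ) • dmPair n a b)) := by
      rw [hT]; push_cast; module
    rw [e]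
    exact hgap.add hm
  · have e : (((4 * |κ| * η * K : ℝ)) : ℂ) • (1 : Op Λ (n + 1)) + (κ : ℂ) • twistBond n δ a b =
        (((4 * |κ| * η * K - 2 * (|u| + |v|) * K : ℝ)) : ℂ) • (1 : Op Λ (n + 1)) +
        ((((2 * (|u| + |v|) * K : ℝ)) : ℂ) • (1 : Op Λ (n + 1)) +
          ((u : ℂ) • xyPair n a b + (v : ℂ) • dmPair n a b)) := by
      rw [hT]; push_cast; module
    rw [e]
    exact hgap.add hp

end Loewner

section StarSpectrum

variable (L : ℕ) [NeZero L] (n : ℕ)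

open scoped MatrixOrder

/-- Smallness of an increment depends on `δ` only through `e^{iδ}`. [folklore] -/
theorem smallIncr_congr {η δ δ' : ℝ} (h : Complex.exp ((δ : ℂ) * I) = Complex.exp ((δ' : ℂ) * I))
    (hs : (|1 - Real.cos (δ')| ≤ η ∧ |Real.sin (δ')| ≤ η)) : (|1 - Real.cos (δ)| ≤ η ∧ |Real.sin (δ)| ≤ η) := by
  have hc : Real.cos δ = Real.cos δ' := by
    have := congrArg Complex.re h
    rwa [Complex.exp_ofReal_mul_I_re, Complex.exp_ofReal_mul_I_re] at this
  have hsn : Real.sin δ = Real.sin δ' := by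
    have := congrArg Complex.im h
    rwa [Complex.exp_ofReal_mul_I_im, Complex.exp_ofReal_mul_I_im] at this
  exact ⟨by rw [hc]; exact hs.1, by rw [hsn]; exact hs.2⟩

/-- A genuinely small angle has small increments: `|δ| ≤ θ ≤ 1 ⇒ |1 - cos δ|, |sin δ| ≤ θ`. [folklore] -/
theorem smallIncr_of_abs_le {δ θ : ℝ} (hδ : |δ| ≤ θ) (hθ : θ ≤ 1) : (|1 - Real.cos (δ)| ≤ θ ∧ |Real.sin (δ)| ≤ θ) := by
  have hθ0 : 0 ≤ θ := (abs_nonneg δ).trans hδ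
  constructor
  · have hcos : 1 - Real.cos δ ≤ δ ^ 2 / 2 := by linarith [Real.one_sub_sq_div_two_le_cos (x := δ)]
    have hcos' : 0 ≤ 1 - Real.cos δ := by linarith [Real.cos_le_one δ]
    rw [abs_of_nonneg hcos']
    have hδ2 : δ ^ 2 ≤ θ ^ 2 := by
      have := sq_abs δ
      nlinarith [abs_nonneg δ]
    nlinarith
  · exact (Real.abs_sin_le_abs (x := δ)).trans hδ

/-- **The Loewner sandwich of the star rule**: with all four increments `η`-small,
`(8η S²/|ε|)·1 ∓ w⋆_x ≥ 0` (`L ≥ 2`). [folklore] -/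
theorem wStar_sandwich (hL : 2 ≤ L) (ψ : TorusSite 2 L → ℝ) {ε : ℝ} (hε : ε ≠ 0) {η : ℝ}
    (hψ : ∀ (x : TorusSite 2 L) (i : Fin 2),
      (|1 - Real.cos (ψ (x + Pi.single i 1) - ψ x)| ≤ η ∧ |Real.sin (ψ (x + Pi.single i 1) - ψ x)| ≤ η) ∧
        (|1 - Real.cos (ψ (x - Pi.single i 1) - ψ x)| ≤ η ∧ |Real.sin (ψ (x - Pi.single i 1) - ψ x)| ≤ η))
    (x : TorusSite 2 L) :
    Matrix.PosSemidef ((((8 * η * ((n : ℝ) / 2) ^ 2 / |ε| : ℝ)) : ℂ) • (1 : Op (TorusSite 2 L) (n + 1)) -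
        wStar L n ψ ε x) ∧
      Matrix.PosSemidef ((((8 * η * ((n : ℝ) / 2) ^ 2 / |ε| : ℝ)) : ℂ) • (1 : Op (TorusSite 2 L) (n + 1)) +
        wStar L n ψ ε x) := by
  set K : ℝ := ((n : ℝ) / 2) ^ 2 with hK
  set κ : ℝ := (2 * ε)⁻¹ with hκ
  have hκabs : |κ| = (2 * |ε|)⁻¹ := by rw [hκ, abs_inv, abs_mul, abs_two]
  have hquarter : 4 * |κ| * η * K = (8 * η * K / |ε|) / 4 := by
    rw [hκabs]
    have : |ε| ≠ 0 := abs_ne_zero.2 hε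
    field_simp
    ring
  -- the four bond terms
  set e0 : TorusSite 2 L := Pi.single 0 1 with he0
  set e1 : TorusSite 2 L := Pi.single 1 1 with he1
  have hw : wStar L n ψ ε x = (κ : ℂ) • twistBond n (ψ (x + e0) - ψ x) x (x + e0) +
      (κ : ℂ) • twistBond n (ψ (x - e0) - ψ x) x (x - e0) +
      ((κ : ℂ) • twistBond n (ψ (x + e1) - ψ x) x (x + e1) +
      (κ : ℂ) • twistBond n (ψ (x - e1) - ψ x) x (x - e1)) := by
    rw [wStar, Fin.sum_univ_two, ← hκ, ← he0, ← he1]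
    simp only [smul_add]
  have hsplit : (((8 * η * K / |ε| : ℝ)) : ℂ) = (((4 * |κ| * η * K : ℝ)) : ℂ) +
      (((4 * |κ| * η * K : ℝ)) : ℂ) + ((((4 * |κ| * η * K : ℝ)) : ℂ) + (((4 * |κ| * η * K : ℝ)) : ℂ)) := by
    rw [hquarter]; push_cast; ring
  have hA0 := posSemidef_sandwich_twistBond n (XYHelix.add_single_ne L hL x 0) κ (hψ x 0).1.1 (hψ x 0).1.2
  have hB0 := posSemidef_sandwich_twistBond n (sub_single_ne L hL x 0) κ (hψ x 0).2.1 (hψ x 0).2.2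
  have hA1 := posSemidef_sandwich_twistBond n (XYHelix.add_single_ne L hL x 1) κ (hψ x 1).1.1 (hψ x 1).1.2
  have hB1 := posSemidef_sandwich_twistBond n (sub_single_ne L hL x 1) κ (hψ x 1).2.1 (hψ x 1).2.2
  rw [← he0] at hA0 hB0
  rw [← he1] at hA1 hB1
  constructor
  · have e : (((8 * η * K / |ε| : ℝ)) : ℂ) • (1 : Op (TorusSite 2 L) (n + 1)) - wStar L n ψ ε x =
        ((((4 * |κ| * η * K : ℝ)) : ℂ) • 1 - (κ : ℂ) • twistBond n (ψ (x + e0) - ψ x) x (x + e0)) +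
        ((((4 * |κ| * η * K : ℝ)) : ℂ) • 1 - (κ : ℂ) • twistBond n (ψ (x - e0) - ψ x) x (x - e0)) +
        (((((4 * |κ| * η * K : ℝ)) : ℂ) • 1 - (κ : ℂ) • twistBond n (ψ (x + e1) - ψ x) x (x + e1)) +
        ((((4 * |κ| * η * K : ℝ)) : ℂ) • 1 - (κ : ℂ) • twistBond n (ψ (x - e1) - ψ x) x (x - e1))) := by
      rw [hw, hsplit]; module
    rw [e]
    exact (hA0.1.add hB0.1).add (hA1.1.add hB1.1)
  · have e : (((8 * η * K / |ε| : ℝ)) : ℂ) • (1 : Op (TorusSite 2 L) (n + 1)) + wStar L n ψ ε x =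
        ((((4 * |κ| * η * K : ℝ)) : ℂ) • 1 + (κ : ℂ) • twistBond n (ψ (x + e0) - ψ x) x (x + e0)) +
        ((((4 * |κ| * η * K : ℝ)) : ℂ) • 1 + (κ : ℂ) • twistBond n (ψ (x - e0) - ψ x) x (x - e0)) +
        (((((4 * |κ| * η * K : ℝ)) : ℂ) • 1 + (κ : ℂ) • twistBond n (ψ (x + e1) - ψ x) x (x + e1)) +
        ((((4 * |κ| * η * K : ℝ)) : ℂ) • 1 + (κ : ℂ) • twistBond n (ψ (x - e1) - ψ x) x (x - e1))) := by
      rw [hw, hsplit]; module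
    rw [e]
    exact (hA0.2.add hB0.2).add (hA1.2.add hB1.2)

/-- **Spectrum of the star rule in `[-1, 1]`** once the increments are `η`-small with
`8 η S² ≤ |ε|` (`L ≥ 2`). [folklore] -/
theorem wStar_eigenvalues (hL : 2 ≤ L) (ψ : TorusSite 2 L → ℝ) {ε : ℝ} (hε : ε ≠ 0) {η : ℝ}
    (hψ : ∀ (x : TorusSite 2 L) (i : Fin 2),
      (|1 - Real.cos (ψ (x + Pi.single i 1) - ψ x)| ≤ η ∧ |Real.sin (ψ (x + Pi.single i 1) - ψ x)| ≤ η) ∧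
        (|1 - Real.cos (ψ (x - Pi.single i 1) - ψ x)| ≤ η ∧ |Real.sin (ψ (x - Pi.single i 1) - ψ x)| ≤ η))
    (hη : 8 * η * ((n : ℝ) / 2) ^ 2 ≤ |ε|) (x : TorusSite 2 L) :
    ∃ hw : (wStar L n ψ ε x).IsHermitian, ∀ i, |hw.eigenvalues i| ≤ 1 := by
  set B : ℝ := 8 * η * ((n : ℝ) / 2) ^ 2 / |ε| with hB
  have hB1 : B ≤ 1 := by
    rw [hB, div_le_one (abs_pos.2 hε)]; exact hη
  obtain ⟨hm, hp⟩ := wStar_sandwich L n hL ψ hε hψ x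
  refine ⟨wStar_isHermitian L n hL ψ ε x, fun i => XYHelix.abs_eigenvalues_le_one _ ?_ ?_ i⟩
  · have e : (1 : Op (TorusSite 2 L) (n + 1)) - wStar L n ψ ε x =
        ((1 - B : ℝ) : ℂ) • (1 : Op (TorusSite 2 L) (n + 1)) + ((B : ℂ) • 1 - wStar L n ψ ε x) := by
      push_cast
      module
    rw [e]
    exact (PosSemidef.one.smul (Complex.zero_le_real.2 (by linarith))).add hm
  · have e : (1 : Op (TorusSite 2 L) (n + 1)) + wStar L n ψ ε x =
        ((1 - B : ℝ) : ℂ) • (1 : Op (TorusSite 2 L) (n + 1)) + ((B : ℂ) • 1 + wStar L n ψ ε x) := by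
      push_cast
      module
    rw [e]
    exact (PosSemidef.one.smul (Complex.zero_le_real.2 (by linarith))).add hp

end StarSpectrum

end XYGaugeTwist

end Literature.MathematicalPhysics.QuantumLattice
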